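import Summits.PneNP.PneNP.Theses.SymmetryBudget
import Literature.Computability.Complexity.SymmetricCircuitCompose

/-!
# The collapse of `WindowHam` modulo symmetric feature circuits (negative-side support,
# crux `stmt-PneNP-2143`)

`windowHam_false_of_features`: `WindowHam` is FALSE as soon as, eventually and within one polynomial,
Hamiltonicity of `m`-vertex graphs is a small GENERAL circuit `D` of polynomially many
`Bud(m,⌊log₂ m⌋)`-symmetric poly-size feature circuits — the kernel-checked composition step
(`Literature…SymmetricCircuitCompose.hasSymCircuit_postcompose`) of the powerset Held–Karp collapse
(crux idea `powerset-heldkarp-collapse`: features = Weisfeiler–Leman ranks of the powerset expansion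
on invariant wires, `D` = an NP padding predicate under NP ⊆ P/poly), leaving exactly the existence of
the features (WL as symmetric circuits) and of `D` (HK `C^k`-definability + P/poly) as the two debts.
With them, `WindowHam → NP ⊄ P/poly`; with Disproof F2 the crux is equivalent to NP ⊄ P/poly.
-/

namespace Summit.PneNP.PneNP.Theorems.WindowHam.Negative

open Literature.Computability.Complexity GateList

section Collapse

open Filter
open Summit.PneNP.PneNP.Theses.SymmetryBudget (WindowHam)
open scoped Classical

/-- **`WindowHam` is false modulo symmetric features.** Suppose that for one polynomial `p` and all
large `m` there are `r` feature circuits `C i` on `m × m` matrices — each over `tcBasis`,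
`Bud(m,⌊log₂ m⌋)`-symmetric, with `≤ s` gates — and a GENERAL `tcBasis` circuit `D` on `r` inputs with
`r * s + |D| ≤ p m` such that `D` applied to the feature bits decides Hamiltonicity of the decoded
graph. Then `¬ WindowHam`. (Steps (2) and (1)+(3) of the powerset Held–Karp collapse are exactly the
two hypotheses; this theorem is its composition step, kernel-checked.) -/
theorem windowHam_false_of_features
    (hF : ∃ p : Polynomial ℕ, ∃ N : ℕ, ∀ m ≥ N, ∃ (r s : ℕ) (C : Fin r → Circuit (Fin m × Fin m))
        (D : Circuit (Fin r)),
        (∀ i, (C i).IsOver tcBasis) ∧ (∀ i, (C i).IsSymmetricUnder (pointStabiliserBudget m (Nat.log 2 m))) ∧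
        (∀ i, (C i).size ≤ s) ∧ D.IsOver tcBasis ∧ r * s + D.size ≤ p.eval m ∧
        ∀ x : Fin m × Fin m → Bool, D.eval (fun i => (C i).eval x) =
          decide (SimpleGraph.fromRel fun u v => x (u, v) = true).IsHamiltonian) :
    ¬ WindowHam := by
  obtain ⟨p, N, hN⟩ := hF
  have key : ∀ m ≥ N, HasSymCircuit tcBasis (pointStabiliserBudget m (Nat.log 2 m)) (p.eval m)
      (fun x : Fin m × Fin m → Bool =>
        decide (SimpleGraph.fromRel fun u v => x (u, v) = true).IsHamiltonian) := by
    intro m hmN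
    obtain ⟨r, s, C, D, hB, hS, hs, hDB, hsize, hcomp⟩ := hN m hmN
    have h := hasSymCircuit_postcompose C (fun i => (C i).eval) hB hS hs (fun i x => rfl) D hDB
      (h := D.eval) (fun y => rfl)
    have hfun : (fun x : Fin m × Fin m → Bool => D.eval fun i => (C i).eval x) =
        (fun x : Fin m × Fin m → Bool =>
          decide (SimpleGraph.fromRel fun u v => x (u, v) = true).IsHamiltonian) := funext hcomp
    rw [hfun] at h
    exact h.mono hsize
  -- `¬ WindowHam`: one polynomial, eventually
  show ¬ ∀ q : Polynomial ℕ, ∃ᶠ m in atTop, ¬ HasSymCircuit tcBasis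
    (pointStabiliserBudget m (Nat.log 2 m)) (q.eval m)
      (fun x : Fin m × Fin m → Bool => decide (SimpleGraph.fromRel fun u v => x (u, v) = true).IsHamiltonian)
  intro hW
  obtain ⟨m, hm, hmN⟩ := ((hW p).and_eventually (eventually_ge_atTop N)).exists
  exact hm (key m hmN)

/-- Entries of the ordered block may be fed to the decoder `D` of `windowHam_false_of_features` as
features of size `0`: the gate-free circuit reading a `Γ`-fixed entry is `Γ`-symmetric. -/
theorem isSymmetricUnder_input_of_fixed {m : ℕ} (Γ : Set (Equiv.Perm (Fin m))) (q : Fin m × Fin m)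
    (hq : ∀ ρ ∈ Γ, (ρ q.1, ρ q.2) = q) : (Circuit.input q).IsSymmetricUnder Γ := by
  intro ρ hρ
  refine ⟨1, ?_, fun j => j.elim0⟩
  show Sum.inl (ρ q.1, ρ q.2) = Sum.inl q
  rw [hq ρ hρ]

/-- In particular for the budget group and an ordered × ordered entry. -/
theorem isSymmetricUnder_input_ordered {m g : ℕ} (q : Fin m × Fin m) (h1 : (q.1 : ℕ) + g < m)
    (h2 : (q.2 : ℕ) + g < m) : (Circuit.input q).IsSymmetricUnder (pointStabiliserBudget m g) :=
  isSymmetricUnder_input_of_fixed _ q fun _ hρ => Prod.ext (hρ q.1 h1) (hρ q.2 h2)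

end Collapse

end Summit.PneNP.PneNP.Theorems.WindowHam.Negative
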